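import Summits.CriticalPhenomena.PercolationContinuityZ3.Theorems.PercNearOneGluingNoHeavyLowerTailSahiE4UnionHoldMoments
import Summits.CriticalPhenomena.PercolationContinuityZ3.Theorems.PercNearOneGluingNoHeavyLowerTailSahiE3ProductRowUnionPartial
import Mathlib.Tactic.LinearCombination
import HarnessLib

/-!
# `NoHeavyLowerTail` (crux stmt-CriticalPhenomena-4575), Sahi programme P4: the order-3 PRODUCT ROW of a member-wise OR family, rung `K = {0,2}`,
# at measure level — `E₃((a_0 ⊕ b_0)·a_1, a_2 ⊕ b_2, a_3) ≥ 0`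

Support file (cell `prim-l12`, seat P4, generation 34; `--supports stmt-CriticalPhenomena-4575`).  No definitions, no named facts, no sorries;
standard axioms.  Measure-level form of `SahiE3ProductRowUnion.e3_prodRow_orK02_nonneg_of_holdMoments` (algebraic core; five-term identity in its
module docstring): `(γ,μ)`, `(β,ν)` finite probability weights, `a : Fin 4 → γ → [0,1]`, `b : Fin 4 → β → [0,1]` with `b_1 = b_3 = 0`; `u_i = a_i ⊕ b_i`.
If the `a`-side satisfies the Harris rows `Cov(a_1,a_3), Cov(a_0a_1,a_3), Cov(a_1,a_2a_3), Cov(a_0a_1a_2,a_3) ≥ 0`, Sahi's `E₃(a_1,a_2,a_3) ≥ 0`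
[Sahi2008, p. 213; LiebSahi2021, (2.1)] and the product row `E₃(a_0a_1,a_2,a_3) ≥ 0`, and the `b`-side satisfies `Cov(b_0,b_2) ≥ 0`, then
`E₃^{μ⊗ν}(u_0u_1, u_2, u_3) ≥ 0`.  On FKG lattices with monotone `a_i, b_i` every hypothesis is an instance of Sahi positivity of orders 2, 3.
Proof: joint moments of `u` (`SahiE4UnionHold.uMoment_S`), inclusion–exclusion (`exFail_S`), `b_1 = b_3 = 0`, the core.  HONEST FRAMING: one rung
of O3P (`b` present in members 0 and 2 only); the four-member statement is work in progress. [this work]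
-/

noncomputable section

namespace Summit.CriticalPhenomena.PercolationContinuityZ3.Theorems.SahiE3ProductRowUnion

open Finset Function Literature.Combinatorics.Sahi2008
open Summit.CriticalPhenomena.PercolationContinuityZ3.Theorems.SahiE3UnionTensor (ex_add' ex_sub' sum_prodWeight ex_tensor)
open Summit.CriticalPhenomena.PercolationContinuityZ3.Theorems.SahiE4UnionHold

variable {γ β : Type*} [Fintype γ] [Fintype β]

/-- **O3P, rung `K = {0,2}`, measure level.**  See the module docstring. [this work] -/
theorem sahiE_three_prodRow_orK02_nonneg (μ : γ → ℝ) (ν : β → ℝ)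
    (hμ0 : ∀ t, 0 ≤ μ t) (hμ1 : ∑ t, μ t = 1) (hν0 : ∀ t, 0 ≤ ν t) (hν1 : ∑ t, ν t = 1)
    (a : Fin 4 → γ → ℝ) (b : Fin 4 → β → ℝ) (ha0 : ∀ i t, 0 ≤ a i t) (ha1 : ∀ i t, a i t ≤ 1) (hb0 : ∀ i t, 0 ≤ b i t) (hb1 : ∀ i t, b i t ≤ 1)
    (hb1z : ∀ t, b 1 t = 0) (hb3z : ∀ t, b 3 t = 0)
    (hk13 : ex μ (a 1) * ex μ (a 3) ≤ ex μ (a 1 * a 3)) (hrho013 : ex μ (a 0 * a 1) * ex μ (a 3) ≤ ex μ (a 0 * a 1 * a 3))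
    (hC1 : ex μ (a 1) * ex μ (a 2 * a 3) ≤ ex μ (a 1 * a 2 * a 3)) (hC2 : ex μ (a 0 * a 1 * a 2) * ex μ (a 3) ≤ ex μ (a 0 * a 1 * a 2 * a 3))
    (he123 : 0 ≤ sahiE μ 3 ![a 1, a 2, a 3]) (hP : 0 ≤ sahiE μ 3 ![a 0 * a 1, a 2, a 3])
    (hl02 : ex ν (b 0) * ex ν (b 2) ≤ ex ν (b 0 * b 2)) :
    0 ≤ sahiE (fun p : γ × β => μ p.1 * ν p.2) 3 ![(fun (i : Fin 4) (p : γ × β) => a i p.1 + b i p.2 - a i p.1 * b i p.2) 0 * (fun (i : Fin 4) (p : γ × β) => a i p.1 + b i p.2 - a i p.1 * b i p.2) 1, (fun (i : Fin 4) (p : γ × β) => a i p.1 + b i p.2 - a i p.1 * b i p.2) 2, (fun (i : Fin 4) (p : γ × β) => a i p.1 + b i p.2 - a i p.1 * b i p.2) 3] := by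
  have pa : ∀ i t, 0 ≤ 1 - a i t := fun i t => sub_nonneg.2 (ha1 i t)
  have ht2 : 0 ≤ ex μ (a 2) := ex_nonneg hμ0 (ha0 2)
  have ht2' : ex μ (a 2) ≤ 1 := by
    have h := ex_mono hμ0 (fun t => ha1 2 t); rwa [ex_const hμ1] at h
  have hat02 : 0 ≤ ex μ (a 1 * a 3) - ex μ (a 0 * a 1 * a 3) - ex μ (a 1 * a 2 * a 3) + ex μ (a 0 * a 1 * a 2 * a 3) := by
    have h : 0 ≤ ex μ (fun t => (1 - a 0 t) * a 1 t * (1 - a 2 t) * a 3 t) :=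
      ex_nonneg hμ0 (fun t => mul_nonneg (mul_nonneg (mul_nonneg (pa 0 t) (ha0 1 t)) (pa 2 t)) (ha0 3 t))
    rw [show (fun t => (1 - a 0 t) * a 1 t * (1 - a 2 t) * a 3 t) = fun t => (a 1 * a 3) t - (a 0 * a 1 * a 3) t - (a 1 * a 2 * a 3) t
        + (a 0 * a 1 * a 2 * a 3) t from funext fun t => by simp only [Pi.mul_apply]; ring] at h
    rwa [ex_add', ex_sub', ex_sub'] at h
  have hs0 : 0 ≤ ex ν (b 0) := ex_nonneg hν0 (hb0 0)
  have hs2 : 0 ≤ ex ν (b 2) := ex_nonneg hν0 (hb0 2)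
  have hs0' : ex ν (b 0) ≤ 1 := by
    have h := ex_mono hν0 (fun t => hb1 0 t); rwa [ex_const hν1] at h
  have hs2' : ex ν (b 2) ≤ 1 := by
    have h := ex_mono hν0 (fun t => hb1 2 t); rwa [ex_const hν1] at h
  have hs02a : ex ν (b 0 * b 2) ≤ ex ν (b 0) := ex_mono hν0 (fun t => by
    simp only [Pi.mul_apply]; exact mul_le_of_le_one_right (hb0 0 t) (hb1 2 t))
  have hs02b : ex ν (b 0 * b 2) ≤ ex ν (b 2) := ex_mono hν0 (fun t => by
    simp only [Pi.mul_apply]; exact mul_le_of_le_one_left (hb0 2 t) (hb1 0 t))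
  have hs02 : 0 ≤ ex ν (b 0 * b 2) := ex_nonneg hν0 (fun t => by simp only [Pi.mul_apply]; exact mul_nonneg (hb0 0 t) (hb0 2 t))
  rw [sahiE_three] at he123 hP
  have z1 : ex ν (b 1) = 0 := by
    rw [show b 1 = fun _ => (0:ℝ) from funext fun t => by simp [hb1z]]; exact ex_const hν1 0
  have z3 : ex ν (b 3) = 0 := by
    rw [show b 3 = fun _ => (0:ℝ) from funext fun t => by simp [hb3z]]; exact ex_const hν1 0
  have z01 : ex ν (b 0 * b 1) = 0 := by
    rw [show b 0 * b 1 = fun _ => (0:ℝ) from funext fun t => by simp [Pi.mul_apply, hb1z]]; exact ex_const hν1 0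
  have z03 : ex ν (b 0 * b 3) = 0 := by
    rw [show b 0 * b 3 = fun _ => (0:ℝ) from funext fun t => by simp [Pi.mul_apply, hb3z]]; exact ex_const hν1 0
  have z12 : ex ν (b 1 * b 2) = 0 := by
    rw [show b 1 * b 2 = fun _ => (0:ℝ) from funext fun t => by simp [Pi.mul_apply, hb1z]]; exact ex_const hν1 0
  have z13 : ex ν (b 1 * b 3) = 0 := by
    rw [show b 1 * b 3 = fun _ => (0:ℝ) from funext fun t => by simp [Pi.mul_apply, hb1z]]; exact ex_const hν1 0
  have z23 : ex ν (b 2 * b 3) = 0 := by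
    rw [show b 2 * b 3 = fun _ => (0:ℝ) from funext fun t => by simp [Pi.mul_apply, hb3z]]; exact ex_const hν1 0
  have z012 : ex ν (b 0 * b 1 * b 2) = 0 := by
    rw [show b 0 * b 1 * b 2 = fun _ => (0:ℝ) from funext fun t => by simp [Pi.mul_apply, hb1z]]; exact ex_const hν1 0
  have z013 : ex ν (b 0 * b 1 * b 3) = 0 := by
    rw [show b 0 * b 1 * b 3 = fun _ => (0:ℝ) from funext fun t => by simp [Pi.mul_apply, hb1z]]; exact ex_const hν1 0
  have z023 : ex ν (b 0 * b 2 * b 3) = 0 := by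
    rw [show b 0 * b 2 * b 3 = fun _ => (0:ℝ) from funext fun t => by simp [Pi.mul_apply, hb3z]]; exact ex_const hν1 0
  have z123 : ex ν (b 1 * b 2 * b 3) = 0 := by
    rw [show b 1 * b 2 * b 3 = fun _ => (0:ℝ) from funext fun t => by simp [Pi.mul_apply, hb1z]]; exact ex_const hν1 0
  have z0123 : ex ν (b 0 * b 1 * b 2 * b 3) = 0 := by
    rw [show b 0 * b 1 * b 2 * b 3 = fun _ => (0:ℝ) from funext fun t => by simp [Pi.mul_apply, hb1z]]; exact ex_const hν1 0
  rw [sahiE_three, uMoment_0123 μ ν hμ1 hν1 a b, uMoment_012 μ ν hμ1 hν1 a b, uMoment_013 μ ν hμ1 hν1 a b, uMoment_01 μ ν hμ1 hν1 a b, uMoment_23 μ ν hμ1 hν1 a b, uMoment_2 μ ν hμ1 hν1 a b, uMoment_3 μ ν hμ1 hν1 a b]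
  rw [exFail_0 μ hμ1 a, exFail_1 μ hμ1 a, exFail_2 μ hμ1 a, exFail_3 μ hμ1 a, exFail_01 μ hμ1 a, exFail_02 μ hμ1 a, exFail_03 μ hμ1 a, exFail_12 μ hμ1 a, exFail_13 μ hμ1 a, exFail_23 μ hμ1 a, exFail_012 μ hμ1 a, exFail_013 μ hμ1 a, exFail_023 μ hμ1 a, exFail_123 μ hμ1 a, exFail_0123 μ hμ1 a]
  rw [exFail_0 ν hν1 b, exFail_1 ν hν1 b, exFail_2 ν hν1 b, exFail_3 ν hν1 b, exFail_01 ν hν1 b, exFail_02 ν hν1 b, exFail_03 ν hν1 b, exFail_12 ν hν1 b, exFail_13 ν hν1 b, exFail_23 ν hν1 b, exFail_012 ν hν1 b, exFail_013 ν hν1 b, exFail_023 ν hν1 b, exFail_123 ν hν1 b, exFail_0123 ν hν1 b]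
  rw [z1, z3, z01, z03, z12, z13, z23, z012, z013, z023, z123, z0123]
  linear_combination e3_prodRow_orK02_nonneg_of_holdMoments (ex μ (a 1)) (ex μ (a 2)) (ex μ (a 3)) (ex μ (a 0 * a 1))
    (ex μ (a 1 * a 2)) (ex μ (a 1 * a 3)) (ex μ (a 2 * a 3)) (ex μ (a 0 * a 1 * a 2)) (ex μ (a 0 * a 1 * a 3)) (ex μ (a 1 * a 2 * a 3))
    (ex μ (a 0 * a 1 * a 2 * a 3)) (ex ν (b 0)) (ex ν (b 2)) (ex ν (b 0 * b 2)) ht2 ht2' hat02 hk13 hrho013 hC1 hC2 he123 hP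
    hs0 hs2 hs0' hs2' hs02a hs02b hs02 hl02

/-- **O3P, rung `K = {0,1}`, measure level**: for `[0,1]`-valued `a : Fin 4 → γ → ℝ`, `b : Fin 4 → β → ℝ` with `b_2 = b_3 = 0` and `u_i = a_i ⊕ b_i`,
`E₃^{μ⊗ν}(u_0u_1, u_2, u_3) ≥ 0` follows from `Cov(a_2,a_3) ≥ 0`, `E₃(a_0,a_2,a_3) ≥ 0`, `E₃(a_1,a_2,a_3) ≥ 0`, `E₃(a_0a_1,a_2,a_3) ≥ 0` and Venn on the
`b` side (no correlation hypothesis on `b` at all).  Core: `e3_prodRow_orK01_nonneg_of_holdMoments`. [this work] -/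
theorem sahiE_three_prodRow_orK01_nonneg (μ : γ → ℝ) (ν : β → ℝ)
    (hμ1 : ∑ t, μ t = 1) (hν0 : ∀ t, 0 ≤ ν t) (hν1 : ∑ t, ν t = 1)
    (a : Fin 4 → γ → ℝ) (b : Fin 4 → β → ℝ) (hb0 : ∀ i t, 0 ≤ b i t) (hb1 : ∀ i t, b i t ≤ 1)
    (hb2z : ∀ t, b 2 t = 0) (hb3z : ∀ t, b 3 t = 0)
    (hk23 : ex μ (a 2) * ex μ (a 3) ≤ ex μ (a 2 * a 3))
    (he023 : 0 ≤ sahiE μ 3 ![a 0, a 2, a 3]) (he123 : 0 ≤ sahiE μ 3 ![a 1, a 2, a 3]) (hP : 0 ≤ sahiE μ 3 ![a 0 * a 1, a 2, a 3]) :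
    0 ≤ sahiE (fun p : γ × β => μ p.1 * ν p.2) 3 ![(fun (i : Fin 4) (p : γ × β) => a i p.1 + b i p.2 - a i p.1 * b i p.2) 0 * (fun (i : Fin 4) (p : γ × β) => a i p.1 + b i p.2 - a i p.1 * b i p.2) 1, (fun (i : Fin 4) (p : γ × β) => a i p.1 + b i p.2 - a i p.1 * b i p.2) 2, (fun (i : Fin 4) (p : γ × β) => a i p.1 + b i p.2 - a i p.1 * b i p.2) 3] := by
  have pb : ∀ i t, 0 ≤ 1 - b i t := fun i t => sub_nonneg.2 (hb1 i t)
  have hy01 : 0 ≤ 1 - ex ν (b 0) - ex ν (b 1) + ex ν (b 0 * b 1) := by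
    have h : 0 ≤ ex ν (fun t => (1 - b 0 t) * (1 - b 1 t)) := ex_nonneg hν0 (fun t => mul_nonneg (pb 0 t) (pb 1 t))
    rwa [exFail_01 ν hν1 b] at h
  have hs01a : ex ν (b 0 * b 1) ≤ ex ν (b 0) := ex_mono hν0 (fun t => by
    simp only [Pi.mul_apply]; exact mul_le_of_le_one_right (hb0 0 t) (hb1 1 t))
  have hs01b : ex ν (b 0 * b 1) ≤ ex ν (b 1) := ex_mono hν0 (fun t => by
    simp only [Pi.mul_apply]; exact mul_le_of_le_one_left (hb0 1 t) (hb1 0 t))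
  have hs01 : 0 ≤ ex ν (b 0 * b 1) := ex_nonneg hν0 (fun t => by simp only [Pi.mul_apply]; exact mul_nonneg (hb0 0 t) (hb0 1 t))
  rw [sahiE_three] at he023 he123 hP
  have z2 : ex ν (b 2) = 0 := by
    rw [show b 2 = fun _ => (0:ℝ) from funext fun t => by simp [hb2z]]; exact ex_const hν1 0
  have z3 : ex ν (b 3) = 0 := by
    rw [show b 3 = fun _ => (0:ℝ) from funext fun t => by simp [hb3z]]; exact ex_const hν1 0
  have z02 : ex ν (b 0 * b 2) = 0 := by
    rw [show b 0 * b 2 = fun _ => (0:ℝ) from funext fun t => by simp [Pi.mul_apply, hb2z]]; exact ex_const hν1 0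
  have z03 : ex ν (b 0 * b 3) = 0 := by
    rw [show b 0 * b 3 = fun _ => (0:ℝ) from funext fun t => by simp [Pi.mul_apply, hb3z]]; exact ex_const hν1 0
  have z12 : ex ν (b 1 * b 2) = 0 := by
    rw [show b 1 * b 2 = fun _ => (0:ℝ) from funext fun t => by simp [Pi.mul_apply, hb2z]]; exact ex_const hν1 0
  have z13 : ex ν (b 1 * b 3) = 0 := by
    rw [show b 1 * b 3 = fun _ => (0:ℝ) from funext fun t => by simp [Pi.mul_apply, hb3z]]; exact ex_const hν1 0
  have z23 : ex ν (b 2 * b 3) = 0 := by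
    rw [show b 2 * b 3 = fun _ => (0:ℝ) from funext fun t => by simp [Pi.mul_apply, hb2z]]; exact ex_const hν1 0
  have z012 : ex ν (b 0 * b 1 * b 2) = 0 := by
    rw [show b 0 * b 1 * b 2 = fun _ => (0:ℝ) from funext fun t => by simp [Pi.mul_apply, hb2z]]; exact ex_const hν1 0
  have z013 : ex ν (b 0 * b 1 * b 3) = 0 := by
    rw [show b 0 * b 1 * b 3 = fun _ => (0:ℝ) from funext fun t => by simp [Pi.mul_apply, hb3z]]; exact ex_const hν1 0
  have z023 : ex ν (b 0 * b 2 * b 3) = 0 := by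
    rw [show b 0 * b 2 * b 3 = fun _ => (0:ℝ) from funext fun t => by simp [Pi.mul_apply, hb2z]]; exact ex_const hν1 0
  have z123 : ex ν (b 1 * b 2 * b 3) = 0 := by
    rw [show b 1 * b 2 * b 3 = fun _ => (0:ℝ) from funext fun t => by simp [Pi.mul_apply, hb2z]]; exact ex_const hν1 0
  have z0123 : ex ν (b 0 * b 1 * b 2 * b 3) = 0 := by
    rw [show b 0 * b 1 * b 2 * b 3 = fun _ => (0:ℝ) from funext fun t => by simp [Pi.mul_apply, hb2z]]; exact ex_const hν1 0
  rw [sahiE_three, uMoment_0123 μ ν hμ1 hν1 a b, uMoment_012 μ ν hμ1 hν1 a b, uMoment_013 μ ν hμ1 hν1 a b, uMoment_01 μ ν hμ1 hν1 a b, uMoment_23 μ ν hμ1 hν1 a b, uMoment_2 μ ν hμ1 hν1 a b, uMoment_3 μ ν hμ1 hν1 a b]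
  rw [exFail_0 μ hμ1 a, exFail_1 μ hμ1 a, exFail_2 μ hμ1 a, exFail_3 μ hμ1 a, exFail_01 μ hμ1 a, exFail_02 μ hμ1 a, exFail_03 μ hμ1 a, exFail_12 μ hμ1 a, exFail_13 μ hμ1 a, exFail_23 μ hμ1 a, exFail_012 μ hμ1 a, exFail_013 μ hμ1 a, exFail_023 μ hμ1 a, exFail_123 μ hμ1 a, exFail_0123 μ hμ1 a]
  rw [exFail_0 ν hν1 b, exFail_1 ν hν1 b, exFail_2 ν hν1 b, exFail_3 ν hν1 b, exFail_01 ν hν1 b, exFail_02 ν hν1 b, exFail_03 ν hν1 b, exFail_12 ν hν1 b, exFail_13 ν hν1 b, exFail_23 ν hν1 b, exFail_012 ν hν1 b, exFail_013 ν hν1 b, exFail_023 ν hν1 b, exFail_123 ν hν1 b, exFail_0123 ν hν1 b]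
  rw [z2, z3, z02, z03, z12, z13, z23, z012, z013, z023, z123, z0123]
  linear_combination e3_prodRow_orK01_nonneg_of_holdMoments (ex μ (a 0)) (ex μ (a 1)) (ex μ (a 2)) (ex μ (a 3)) (ex μ (a 0 * a 1))
    (ex μ (a 0 * a 2)) (ex μ (a 0 * a 3)) (ex μ (a 1 * a 2)) (ex μ (a 1 * a 3)) (ex μ (a 2 * a 3)) (ex μ (a 0 * a 1 * a 2))
    (ex μ (a 0 * a 1 * a 3)) (ex μ (a 0 * a 2 * a 3)) (ex μ (a 1 * a 2 * a 3)) (ex μ (a 0 * a 1 * a 2 * a 3))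
    (ex ν (b 0)) (ex ν (b 1)) (ex ν (b 0 * b 1)) hk23 he023 he123 hP hy01 hs01a hs01b hs01
end Summit.CriticalPhenomena.PercolationContinuityZ3.Theorems.SahiE3ProductRowUnion

end
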